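import Summits.QuantumFields.YangMills.Theorems.MirrorModularBoostsCurvatureBoostCovarianceRayPositivityCore
import Summits.QuantumFields.YangMills.Theorems.NPointIsotropy.Negative.NPointRegularJunk
import Summits.QuantumFields.YangMills.Theorems.MirrorModularBoostsPlanarSpectralConeDensityHelpers

/-!
# Insertion operators from a sandwich-type estimate — stub `stub_insertionOps`

Line `Sketch` of crux `MirrorModularBoosts.SoftKernelBoostCovariance` (stmt-QuantumFields-14999), stub (T1) of the
registered skeleton `Cruxes/SoftKernelBoostCovariance/Lines/Sketch.lean`.  Model-blind Osterwalder–Schrader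
bookkeeping over the `e₀`-reconstruction `h : OSReconstructionNoE1 S₁.toLabelled` of a one-species Schwinger family
`S₁` on `ℝ⁴` (file `Literature/MathematicalPhysics/QuantumFieldTheory/OSReconstructionNoE1.lean`: Hilbert space
`h.Hilbert`, field vectors `h.fieldVec n k W hW = Ψ_W`).

**Statement** (`stub_insertionOps`).  Fix a degree `n`, a one-point test function `f₁`, a shift `c ∈ ℝ⁴` and a
constant `K`.  Call a degree-`n` test function `W` *admissible* if `W` and `f₁ ⊗ W_c` are time-ordered
(`W_c = translateMulti c W`, `⊗ = SchwartzMap.appendTensor`).  If `‖Ψ_{f₁ ⊗ W_c}‖ ≤ K ‖Ψ_W‖` for every admissible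
`W`, then there is a bounded operator `B` on `h.Hilbert` with `‖B‖ ≤ max K 0` and `B Ψ_W = Ψ_{f₁ ⊗ W_c}` for every
admissible `W`.

**Proof.**
1. The admissible `W` form a `ℂ`-subspace `A` of `𝓢((ℝ⁴)ⁿ)` (supports of sums and scalar multiples;
   `W ↦ f₁ ⊗ W_c` is linear: `translateMulti c` is a continuous linear map and `appendTensor` is additive and
   homogeneous in its second factor — `appendTensor_translateMulti_add/smul/zero`).
2. `W ↦ Ψ_W` and `W ↦ Ψ_{f₁ ⊗ W_c}` are LINEAR maps `A →ₗ[ℂ] h.Hilbert`: `Ψ_{W + W'} = Ψ_W + Ψ_{W'}` and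
   `Ψ_{aW} = a Ψ_W` in `h.Hilbert` (the differences are null vectors of the OS form; landed one-species API
   `Density.fieldVec_add` / `Density.fieldVec_smul` of item 9664, and `fieldVec_insertion_add/smul` here).
3. Abstract extension (`exists_clm_extension_of_norm_le`): for linear maps `e, f : V →ₗ[ℂ] H` into a Hilbert space
   with `‖f x‖ ≤ K ‖e x‖`, the map `e x ↦ f x` is well defined and bounded by `max K 0` on `range e`, extends by
   continuity to the closure `M` of `range e` (`LinearMap.extendOfNorm`, as in `OSReconstructionNoE1.transfer`), and
   precomposing with the orthogonal projection onto `M` (norm `≤ 1`) gives `B : H →L[ℂ] H` with `‖B‖ ≤ max K 0` and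
   `B (e x) = f x`.
Apply 3 to the two maps of 2 (built locally in the proof); the hypothesis is exactly the bound.

References: K. Osterwalder, R. Schrader, CMP 31 (1973), §4.1 (4.4) (the map `v` and its null space); J. Glimm,
A. Jaffe, *Quantum Physics* (2nd ed. 1987), Prop. 6.1.1 (operators on `ℋ` from bounded maps on `ℰ₊`).
-/

noncomputable section

namespace Summit.QuantumFields.YangMills.Theorems.SoftKernelBoostCovariance.Sketch

open scoped InnerProductSpace SchwartzMap
open Literature.MathematicalPhysics.QuantumLattice Literature.MathematicalPhysics.AQFT
  Literature.MathematicalPhysics.QuantumFieldTheory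
open Summit.QuantumFields.YangMills.Theorems.NPointIsotropy.Negative (E4)
open Summit.QuantumFields.YangMills.Cruxes.PlanarSpectralCone.PositivityDiscToOperatorCone.Density
  (isTimeOrdered_add fieldVec_add fieldVec_smul fieldVec_congr)

/-! ## Abstract extension of a relatively bounded linear map to a bounded operator -/

/-- **Bounded operator from a relatively bounded pair of linear maps.**  Let `H` be a complex Hilbert space, `V` a
`ℂ`-module and `e f : V →ₗ[ℂ] H` linear maps with `‖f x‖ ≤ K ‖e x‖` for all `x`.  Then there is a bounded operator
`B : H →L[ℂ] H` with `‖B‖ ≤ max K 0` and `B (e x) = f x` for all `x`: extend `e x ↦ f x` by continuity to the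
closure of `range e` (`LinearMap.extendOfNorm`) and by zero on its orthogonal complement (orthogonal projection). -/
theorem exists_clm_extension_of_norm_le {H : Type*} [NormedAddCommGroup H] [InnerProductSpace ℂ H]
    [CompleteSpace H] {V : Type*} [AddCommGroup V] [Module ℂ V] (e f : V →ₗ[ℂ] H) (K : ℝ)
    (hK : ∀ x, ‖f x‖ ≤ K * ‖e x‖) :
    ∃ B : H →L[ℂ] H, ‖B‖ ≤ max K 0 ∧ ∀ x, B (e x) = f x := by
  -- the closure `M` of the range of `e`, a complete subspace
  set M : Submodule ℂ H := (LinearMap.range e).topologicalClosure with hM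
  have hmem : ∀ x, e x ∈ M := fun x =>
    (LinearMap.range e).le_topologicalClosure (LinearMap.mem_range_self e x)
  -- `e` with values in `M`, dense range
  set e' : V →ₗ[ℂ] M := LinearMap.codRestrict M e hmem with he'
  have he'x : ∀ x, (e' x : H) = e x := fun x => rfl
  have hd : DenseRange e' := by
    rw [DenseRange, Subtype.dense_iff]
    intro y hy
    rw [hM, Submodule.topologicalClosure_coe, LinearMap.coe_range] at hy
    refine closure_mono ?_ hy
    rintro _ ⟨x, rfl⟩
    exact ⟨e' x, ⟨x, rfl⟩, rfl⟩
  -- the bound with the nonnegative constant `max K 0`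
  have hK' : ∀ x, ‖f x‖ ≤ max K 0 * ‖e' x‖ := fun x => by
    rw [Submodule.coe_norm, he'x]
    exact (hK x).trans (mul_le_mul_of_nonneg_right (le_max_left _ _) (norm_nonneg _))
  -- the extension and the projection
  set T : M →L[ℂ] H := f.extendOfNorm e' with hT
  refine ⟨T ∘L M.orthogonalProjectionOnto, ?_, fun x => ?_⟩
  · calc ‖T ∘L M.orthogonalProjectionOnto‖ ≤ ‖T‖ * ‖M.orthogonalProjectionOnto‖ :=
          ContinuousLinearMap.opNorm_comp_le _ _
      _ ≤ max K 0 * 1 :=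
          mul_le_mul (LinearMap.opNorm_extendOfNorm_le hd (le_max_right _ _) hK')
            M.orthogonalProjectionOnto_norm_le (ContinuousLinearMap.opNorm_nonneg _) (le_max_right _ _)
      _ = max K 0 := mul_one _
  · have h1 : M.orthogonalProjectionOnto (e x) = e' x :=
      M.orthogonalProjectionOnto_mem_subspace_eq_self (e' x)
    rw [ContinuousLinearMap.comp_apply, h1, hT, LinearMap.extendOfNorm_eq hd ⟨max K 0, hK'⟩]

/-! ## Linearity of `W ↦ f₁ ⊗ W_c` and of the insertion field vectors -/

/-- The zero test function is time-ordered (its support is empty). -/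
theorem isTimeOrdered_zero' {n : ℕ} : IsTimeOrdered (0 : 𝓢((Fin n → E4), ℂ)) := by
  have h0 : ((0 : 𝓢((Fin n → E4), ℂ)) : (Fin n → E4) → ℂ) = 0 := rfl
  rw [IsTimeOrdered, h0, tsupport_zero]
  exact Set.empty_subset _

/-- `W ↦ f₁ ⊗ W_c` (prepend the insertion `f₁` to the `c`-translate) is additive. -/
theorem appendTensor_translateMulti_add {n : ℕ} (f₁ : 𝓢((Fin 1 → E4), ℂ)) (c : E4)
    (W W' : 𝓢((Fin n → E4), ℂ)) :
    SchwartzMap.appendTensor f₁ (translateMulti c (W + W')) =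
      SchwartzMap.appendTensor f₁ (translateMulti c W) + SchwartzMap.appendTensor f₁ (translateMulti c W') := by
  rw [map_add, SchwartzMap.appendTensor_add_right]

/-- `W ↦ f₁ ⊗ W_c` is homogeneous. -/
theorem appendTensor_translateMulti_smul {n : ℕ} (f₁ : 𝓢((Fin 1 → E4), ℂ)) (c : E4) (a : ℂ)
    (W : 𝓢((Fin n → E4), ℂ)) :
    SchwartzMap.appendTensor f₁ (translateMulti c (a • W)) =
      a • SchwartzMap.appendTensor f₁ (translateMulti c W) := by
  rw [map_smul, SchwartzMap.appendTensor_smul_right]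

/-- `f₁ ⊗ 0_c = 0`. -/
theorem appendTensor_translateMulti_zero {n : ℕ} (f₁ : 𝓢((Fin 1 → E4), ℂ)) (c : E4) :
    SchwartzMap.appendTensor f₁ (translateMulti c (0 : 𝓢((Fin n → E4), ℂ))) = 0 := by
  rw [← zero_smul ℂ (0 : 𝓢((Fin n → E4), ℂ)), appendTensor_translateMulti_smul, zero_smul]

variable {S₁ : SchwingerFamily E4}

/-- `Ψ_{f₁ ⊗ (W + W')_c} = Ψ_{f₁ ⊗ W_c} + Ψ_{f₁ ⊗ W'_c}` in `h.Hilbert`. -/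
theorem fieldVec_insertion_add (h : OSReconstructionNoE1 S₁.toLabelled) {n : ℕ} (f₁ : 𝓢((Fin 1 → E4), ℂ))
    (c : E4) {W W' : 𝓢((Fin n → E4), ℂ)}
    (hW : IsTimeOrdered (SchwartzMap.appendTensor f₁ (translateMulti c W)))
    (hW' : IsTimeOrdered (SchwartzMap.appendTensor f₁ (translateMulti c W')))
    (hWW' : IsTimeOrdered (SchwartzMap.appendTensor f₁ (translateMulti c (W + W')))) :
    h.fieldVec (1 + n) (fun _ => ()) (SchwartzMap.appendTensor f₁ (translateMulti c (W + W'))) hWW' =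
      h.fieldVec (1 + n) (fun _ => ()) (SchwartzMap.appendTensor f₁ (translateMulti c W)) hW +
        h.fieldVec (1 + n) (fun _ => ()) (SchwartzMap.appendTensor f₁ (translateMulti c W')) hW' := by
  rw [fieldVec_congr h (appendTensor_translateMulti_add f₁ c W W') hWW' (isTimeOrdered_add hW hW')]
  exact fieldVec_add h hW hW' _

/-- `Ψ_{f₁ ⊗ (a W)_c} = a Ψ_{f₁ ⊗ W_c}` in `h.Hilbert`. -/
theorem fieldVec_insertion_smul (h : OSReconstructionNoE1 S₁.toLabelled) {n : ℕ} (f₁ : 𝓢((Fin 1 → E4), ℂ))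
    (c : E4) (a : ℂ) {W : 𝓢((Fin n → E4), ℂ)}
    (hW : IsTimeOrdered (SchwartzMap.appendTensor f₁ (translateMulti c W)))
    (haW : IsTimeOrdered (SchwartzMap.appendTensor f₁ (translateMulti c (a • W)))) :
    h.fieldVec (1 + n) (fun _ => ()) (SchwartzMap.appendTensor f₁ (translateMulti c (a • W))) haW =
      a • h.fieldVec (1 + n) (fun _ => ()) (SchwartzMap.appendTensor f₁ (translateMulti c W)) hW := by
  rw [fieldVec_congr h (appendTensor_translateMulti_smul f₁ c a W) haW
    (OSReconstructionNoE1.isTimeOrdered_smul a hW)]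
  exact fieldVec_smul h a hW _

/-! ## The stub -/

/-- **Stub (T1) — INSERTION OPERATORS FROM A SANDWICH-TYPE ESTIMATE (model-blind OS bookkeeping).**  For an
`e₀`-reconstruction `h`, a degree `n`, a one-point test function `f₁`, a shift `c` and a constant `K`: if prepending
`f₁` to the `c`-translate of every admissible degree-`n` time-ordered `W` multiplies the OS norm by at most `K`, then
there is a bounded operator `B` on `ℋ` with `‖B‖ ≤ max K 0` that does exactly this on the field vectors.  Proof:
`W ↦ Ψ_W` and `W ↦ Ψ_{f₁ ⊗ W_c}` are linear on the admissible subspace (field vectors are additive and homogeneous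
in the test function up to null vectors), the hypothesis is a relative bound, and `exists_clm_extension_of_norm_le`
packages it as an operator (extension by continuity to the closed span, zero on the orthogonal complement). -/
theorem stub_insertionOps :
    open Literature.MathematicalPhysics.QuantumLattice Literature.MathematicalPhysics.AQFT
      Literature.MathematicalPhysics.QuantumFieldTheory
      Summit.QuantumFields.YangMills.Theorems.CurvatureBoostCovariance.Negative
      Summit.QuantumFields.YangMills.Theorems.NPointIsotropy.Negative in
    ∀ (S₁ : SchwingerFamily E4) (h : OSReconstructionNoE1 S₁.toLabelled) (n : ℕ)
        (f₁ : SchwartzMap (Fin 1 → E4) ℂ) (c : E4) (K : ℝ),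
        (∀ (W : SchwartzMap (Fin n → E4) ℂ) (hW : IsTimeOrdered W)
          (hFW : IsTimeOrdered (SchwartzMap.appendTensor f₁ (translateMulti c W))),
          ‖h.fieldVec (1 + n) (fun _ => ()) (SchwartzMap.appendTensor f₁ (translateMulti c W)) hFW‖ ≤
            K * ‖h.fieldVec n (fun _ => ()) W hW‖) →
        ∃ B : h.Hilbert →L[ℂ] h.Hilbert, ‖B‖ ≤ max K 0 ∧
          ∀ (W : SchwartzMap (Fin n → E4) ℂ) (hW : IsTimeOrdered W)
            (hFW : IsTimeOrdered (SchwartzMap.appendTensor f₁ (translateMulti c W))),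
            B (h.fieldVec n (fun _ => ()) W hW) =
              h.fieldVec (1 + n) (fun _ => ()) (SchwartzMap.appendTensor f₁ (translateMulti c W)) hFW := by
  intro S₁ h n f₁ c K hK
  -- the admissible subspace: `W` and `f₁ ⊗ W_c` time-ordered
  let A : Submodule ℂ 𝓢((Fin n → E4), ℂ) :=
    { carrier := {W | IsTimeOrdered W ∧ IsTimeOrdered (SchwartzMap.appendTensor f₁ (translateMulti c W))}
      add_mem' := fun {W W'} hW hW' =>
        ⟨isTimeOrdered_add hW.1 hW'.1, by
          rw [appendTensor_translateMulti_add]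
          exact isTimeOrdered_add hW.2 hW'.2⟩
      zero_mem' :=
        ⟨isTimeOrdered_zero', by
          rw [appendTensor_translateMulti_zero]
          exact isTimeOrdered_zero'⟩
      smul_mem' := fun a W hW =>
        ⟨OSReconstructionNoE1.isTimeOrdered_smul a hW.1, by
          rw [appendTensor_translateMulti_smul]
          exact OSReconstructionNoE1.isTimeOrdered_smul a hW.2⟩ }
  -- the two linear maps `W ↦ Ψ_W`, `W ↦ Ψ_{f₁ ⊗ W_c}` on `A`
  let e : A →ₗ[ℂ] h.Hilbert :=
    { toFun := fun W => h.fieldVec n (fun _ => ()) (W : 𝓢((Fin n → E4), ℂ)) W.2.1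
      map_add' := fun W W' => fieldVec_add h W.2.1 W'.2.1 _
      map_smul' := fun a W => fieldVec_smul h a W.2.1 _ }
  let f : A →ₗ[ℂ] h.Hilbert :=
    { toFun := fun W => h.fieldVec (1 + n) (fun _ => ())
        (SchwartzMap.appendTensor f₁ (translateMulti c (W : 𝓢((Fin n → E4), ℂ)))) W.2.2
      map_add' := fun W W' => fieldVec_insertion_add h f₁ c W.2.2 W'.2.2 _
      map_smul' := fun a W => fieldVec_insertion_smul h f₁ c a W.2.2 _ }
  -- the hypothesis is the relative bound; package it as an operator
  obtain ⟨B, hB, hBe⟩ := exists_clm_extension_of_norm_le e f K fun W => hK W W.2.1 W.2.2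
  exact ⟨B, hB, fun W hW hFW => hBe ⟨W, hW, hFW⟩⟩

end Summit.QuantumFields.YangMills.Theorems.SoftKernelBoostCovariance.Sketch

end
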